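import Literature.AnabelianGeometry.AbsoluteAnabelian.ArchimedeanHolFieldFunctorGeometricPSLNormalizerFiniteCusped
import HarnessLib

/-!
# `[N(Λ̄) : Λ̄] < ∞` for every finite-index `Λ̄ ≤ Γ̄`: the cusp hypotheses descend

Classical input for [AbsTopIII] Prop 4.2 (i) (S. Mochizuki, *Topics in Absolute Anabelian Geometry
III*, proof of Proposition 4.2 (i), p. 106), PUNCTURED case, in the shape the consumers quantify over:
the closers of the geometric column (`HolRS.isIdRigid_mapsTo_in_EA_of`, `…_of_isFreeGroup`) take
`hN : ∀ Λ : LocObj Γ̄, [N(Λ̄) : Λ̄] < ∞` for ALL finite-index `Λ̄ ≤ Γ̄` (the connected finite étale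
covers `ℍ/Λ̄ → ℍ/Γ̄`).  abc-iut-L4-d1's `finiteIndex_subgroupOf_normalizer_of_cusps` proves
`[N(Γ̄) : Γ̄] < ∞` from (P) "a parabolic in `Γ̄`" and (FC) "finitely many `Γ̄`-classes of cusps";
this PROOF-ONLY file (abc-iut cell, row «J2i-CUSPED» complement, seat abc-iut-L4-d1; no definitions,
no named facts) shows that (P) and (FC) DESCEND from `Γ̄` to every finite-index `Λ̄ ≤ Γ̄`
(`cusps_hypotheses_of_le`: a power of a parabolic is parabolic — Mathlib's `IsParabolic.pow` — and the
`Γ̄`-classes of cusps split into at most `[Γ̄ : Λ̄]` `Λ̄`-classes, represented by `γ_q⁻¹ w`), hence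
`[N(Λ̄) : Λ̄] < ∞` for every non-abelian finite-index `Λ̄ ≤ Γ̄` from the cusp data of `Γ̄` ALONE
(`finiteIndex_subgroupOf_normalizer_of_cusps_of_le`) — the cusped twin of the compact-case transfer
`compactSpace_orbitRelQuotient_of_finiteIndex`.  HONEST FRAMING: classical (Farkas–Kra IV.5–6,
Shimura §1.5), MODEL side of [AbsTopIII] §4 only; nothing here bears on [IUTchIII] Cor. 3.12.
-/

noncomputable section

open scoped UpperHalfPlane MatrixGroups Matrix Topology
open _root_.MulAction

namespace Literature.AnabelianGeometry.AbsoluteAnabelian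

namespace HolRS

variable (Γ Λ : Subgroup PSL2R)

/-- **The cusp hypotheses (P), (FC) descend to finite-index subgroups.**  If `Λ̄ ≤ Γ̄` has finite
index and `Γ̄` has (P) a parabolic lift and (FC) a finite set `F` of cusp representatives, then so does
`Λ̄`: a parabolic `t ∈ Γ̃` has a parabolic power `tⁿ ∈ Λ̃` (`n ≤ [Γ̄ : Λ̄]`), and with lifts `γ_q` of coset
representatives the finite set `{γ_q⁻¹ w}` represents the cusps up to `Λ̃`.
[cite: MochizukiAbsTopIII2015, Proposition 4.2 (i) proof p.106] [cite: FarkasKra1992, IV.5.6] -/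
theorem cusps_hypotheses_of_le (hΛΓ : Λ ≤ Γ) [(Λ.subgroupOf Γ).FiniteIndex]
    (hP : ∃ t : SL(2, ℝ), QuotientGroup.mk' (Subgroup.center SL(2, ℝ)) t ∈ Γ ∧
      (t : Matrix (Fin 2) (Fin 2) ℝ).IsParabolic)
    (hFC : ∃ F : Finset (Fin 2 → ℝ), ∀ t : SL(2, ℝ),
      QuotientGroup.mk' (Subgroup.center SL(2, ℝ)) t ∈ Γ → (t : Matrix (Fin 2) (Fin 2) ℝ).IsParabolic →
      ∀ v : Fin 2 → ℝ, v ≠ 0 → (∃ c : ℝ, (t : Matrix (Fin 2) (Fin 2) ℝ) *ᵥ v = c • v) →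
      ∃ g : SL(2, ℝ), QuotientGroup.mk' (Subgroup.center SL(2, ℝ)) g ∈ Γ ∧ ∃ w ∈ F, ∃ c : ℝ,
        (g : Matrix (Fin 2) (Fin 2) ℝ) *ᵥ v = c • w) :
    (∃ t : SL(2, ℝ), QuotientGroup.mk' (Subgroup.center SL(2, ℝ)) t ∈ Λ ∧
      (t : Matrix (Fin 2) (Fin 2) ℝ).IsParabolic) ∧
    (∃ F : Finset (Fin 2 → ℝ), ∀ t : SL(2, ℝ),
      QuotientGroup.mk' (Subgroup.center SL(2, ℝ)) t ∈ Λ → (t : Matrix (Fin 2) (Fin 2) ℝ).IsParabolic →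
      ∀ v : Fin 2 → ℝ, v ≠ 0 → (∃ c : ℝ, (t : Matrix (Fin 2) (Fin 2) ℝ) *ᵥ v = c • v) →
      ∃ g : SL(2, ℝ), QuotientGroup.mk' (Subgroup.center SL(2, ℝ)) g ∈ Λ ∧ ∃ w ∈ F, ∃ c : ℝ,
        (g : Matrix (Fin 2) (Fin 2) ℝ) *ᵥ v = c • w) := by
  classical
  let π : SL(2, ℝ) →* PSL2R := QuotientGroup.mk' (Subgroup.center SL(2, ℝ))
  have hidx : (Λ.subgroupOf Γ).index ≠ 0 := Subgroup.FiniteIndex.index_ne_zero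
  refine ⟨?_, ?_⟩
  · -- (P): a power of the parabolic lands in `Λ̄` and is parabolic
    obtain ⟨t, htΓ, htpar⟩ := hP
    obtain ⟨n, hn, -, hmem⟩ := Subgroup.exists_pow_mem_of_index_ne_zero hidx (⟨π t, htΓ⟩ : Γ)
    refine ⟨t ^ n, ?_, ?_⟩
    · rw [Subgroup.mem_subgroupOf, SubgroupClass.coe_pow] at hmem
      change π (t ^ n) ∈ Λ
      rw [map_pow]
      exact hmem
    · have h1 : Matrix.GeneralLinearGroup.IsParabolic (Matrix.SpecialLinearGroup.toGL t) := htpar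
      have h2 := h1.pow (n := n) hn.ne'
      rw [← map_pow] at h2
      exact h2
  · -- (FC): translate the representatives by lifts of coset representatives of `Γ̄/Λ̄`
    obtain ⟨F, hF⟩ := hFC
    -- lifts `γ_q ∈ SL(2, ℝ)` of representatives of the classes `q ∈ Γ̄/Λ̄`
    let γ : Γ ⧸ Λ.subgroupOf Γ → SL(2, ℝ) := fun q =>
      (QuotientGroup.mk_surjective ((Quotient.out q : Γ) : PSL2R)).choose
    have hγ : ∀ q, π (γ q) = ((Quotient.out q : Γ) : PSL2R) := fun q =>
      (QuotientGroup.mk_surjective ((Quotient.out q : Γ) : PSL2R)).choose_spec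
    haveI : Fintype (Γ ⧸ Λ.subgroupOf Γ) := Subgroup.fintypeQuotientOfFiniteIndex
    let f : (Γ ⧸ Λ.subgroupOf Γ) × (Fin 2 → ℝ) → (Fin 2 → ℝ) := fun p =>
      (((γ p.1)⁻¹ : SL(2, ℝ)) : Matrix (Fin 2) (Fin 2) ℝ) *ᵥ p.2
    refine ⟨(Finset.univ ×ˢ F).image f, ?_⟩
    intro t htΛ htpar v hv hev
    obtain ⟨g, hgΓ, w, hwF, c, hgc⟩ := hF t (hΛΓ htΛ) htpar v hv hev
    let q : Γ ⧸ Λ.subgroupOf Γ := QuotientGroup.mk ⟨π g, hgΓ⟩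
    -- `γ_q⁻¹ g ∈ Λ̃`
    have hq : ((Quotient.out q : Γ) : PSL2R)⁻¹ * π g ∈ Λ := by
      have h1 : (QuotientGroup.mk (Quotient.out q) : Γ ⧸ Λ.subgroupOf Γ) = QuotientGroup.mk ⟨π g, hgΓ⟩ :=
        QuotientGroup.out_eq' q
      have h2 := QuotientGroup.eq.mp h1
      rw [Subgroup.mem_subgroupOf, Subgroup.coe_mul, Subgroup.coe_inv] at h2
      exact h2
    refine ⟨(γ q)⁻¹ * g, ?_, f (q, w), ?_, c, ?_⟩
    · change π ((γ q)⁻¹ * g) ∈ Λ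
      rw [map_mul, map_inv, hγ]
      exact hq
    · exact Finset.mem_image.mpr ⟨(q, w), Finset.mem_product.mpr ⟨Finset.mem_univ _, hwF⟩, rfl⟩
    · change (((γ q)⁻¹ * g : SL(2, ℝ)) : Matrix (Fin 2) (Fin 2) ℝ) *ᵥ v =
        c • ((((γ q)⁻¹ : SL(2, ℝ)) : Matrix (Fin 2) (Fin 2) ℝ) *ᵥ w)
      rw [Matrix.SpecialLinearGroup.coe_mul, ← Matrix.mulVec_mulVec, hgc, Matrix.mulVec_smul]

/-- **`[N_{PSL₂(ℝ)}(Λ̄) : Λ̄] < ∞` for every non-abelian finite-index `Λ̄ ≤ Γ̄`, from the cusp data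
of `Γ̄` alone** (`Γ̄` properly discontinuous with (P) a parabolic and (FC) finitely many cusp classes):
the hypothesis `hN : ∀ Λ : LocObj Γ̄, [N(Λ̄) : Λ̄] < ∞` of the geometric [AbsTopIII] Prop 4.2 (i)
closers, discharged at the uniformising group of a punctured hyperbolic Riemann surface of finite type.
[cite: MochizukiAbsTopIII2015, Proposition 4.2 (i) proof p.106] [cite: FarkasKra1992, IV.5.6] -/
theorem finiteIndex_subgroupOf_normalizer_of_cusps_of_le [ProperlyDiscontinuousSMul Γ ℍ]
    (hΛΓ : Λ ≤ Γ) [(Λ.subgroupOf Γ).FiniteIndex] (hΛ : ∃ x y : Λ, x * y ≠ y * x)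
    (hP : ∃ t : SL(2, ℝ), QuotientGroup.mk' (Subgroup.center SL(2, ℝ)) t ∈ Γ ∧
      (t : Matrix (Fin 2) (Fin 2) ℝ).IsParabolic)
    (hFC : ∃ F : Finset (Fin 2 → ℝ), ∀ t : SL(2, ℝ),
      QuotientGroup.mk' (Subgroup.center SL(2, ℝ)) t ∈ Γ → (t : Matrix (Fin 2) (Fin 2) ℝ).IsParabolic →
      ∀ v : Fin 2 → ℝ, v ≠ 0 → (∃ c : ℝ, (t : Matrix (Fin 2) (Fin 2) ℝ) *ᵥ v = c • v) →
      ∃ g : SL(2, ℝ), QuotientGroup.mk' (Subgroup.center SL(2, ℝ)) g ∈ Γ ∧ ∃ w ∈ F, ∃ c : ℝ,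
        (g : Matrix (Fin 2) (Fin 2) ℝ) *ᵥ v = c • w) :
    (Λ.subgroupOf (Subgroup.normalizer (Λ : Set PSL2R))).FiniteIndex := by
  haveI : ProperlyDiscontinuousSMul Λ ℍ := by
    refine ⟨fun {K L} hK hL => ?_⟩
    have hfin := ProperlyDiscontinuousSMul.finite_disjoint_inter_image (Γ := Γ) hK hL
    exact (hfin.preimage (Subgroup.inclusion_injective hΛΓ).injOn).subset fun γ hγ => hγ
  obtain ⟨hP', hFC'⟩ := cusps_hypotheses_of_le Γ Λ hΛΓ hP hFC
  exact finiteIndex_subgroupOf_normalizer_of_cusps Λ hΛ hP' hFC'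

end HolRS

end Literature.AnabelianGeometry.AbsoluteAnabelian

end
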